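import Literature.Combinatorics.Optimization.PatternMatrixPsdRank
import Literature.Combinatorics.Optimization.PsdRankBasicProperties
import HarnessLib

/-!
# Relationships between rank, nonnegative rank, square-root rank and psd rank (FGPRT 2015, §5)

Source: H. Fawzi, J. Gouveia, P. A. Parrilo, R. Z. Robinson, R. R. Thomas, *Positive semidefinite
rank*, Math. Program. Ser. B 153 (2015) 133–177 = arXiv:1407.4095 [FawziEtAl2015], §5
"Relationships between ranks" (held text `paper:arxiv-1407.4095`, chunks p14–p17; theorem numbers
are those of the arXiv version, as in the cell's memos). Vocabulary: the tree's
`HasPsdFactorization M k` ("`rank_psd(M) ≤ k`", FGPRT Def. 2.2); nonnegative factorizations are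
inlined (`M i j = Σ_l U i l * V l j`, `U, V ≥ 0`).

Contents.
* Example 5.1 (derangement matrices `D_n`: `rank_psd(D_n) = min{k : n ≤ C(k+1,2)}`): definition
  `derangementMatrix`, NAMED FACT `FawziEtAl2015_ex51`, DISCHARGED (`FawziEtAl2015_ex51_holds`: the
  printed factorization of `D_{C(k+1,2)}` on the indices `{s ≤ t}`, `hasPsdFactorization_derangement_pairsLE`,
  and `rank_derangementMatrix`).
* Definition 5.2 (square root rank): `HasHadamardSqrtOfRankLE M r` ("`rank_√(M) ≤ r`").
* Corollary 5.3 (`rank_psd ≤ rank_√`; for `0/1` matrices `rank_psd ≤ rank`): PROVED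
  (`HasHadamardSqrtOfRankLE.hasPsdFactorization`, `hasPsdFactorization_rank_of_zero_one`).
* Lemma 5.4 (Barvinok: `rank f(A) ≤ C(k + rank A, k)` for a polynomial `f` of degree `k` applied
  entrywise): NAMED FACT `FawziEtAl2015_lemma54`.
* Corollary 5.5 (Barvinok: `≤ k` distinct entries ⇒ `rank_psd(M) ≤ C(k−1+rank M, k−1)`): NAMED FACT
  `FawziEtAl2015_cor55`, and PROVED from Lemma 5.4 (`FawziEtAl2015_cor55_of_lemma54`, Lagrange
  interpolation of `√·` on the entry set + Corollary 5.3) — the mechanism the cell's kernel file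
  `Summit.PneNP.….ChebyshevTracialDesignLevelCountFooling` instantiates on odd-cut slacks.
* Theorem 5.8 (Lee–Theis: over a fixed support, `min rank = min_{A ≥ 0} rank_psd`): the direction
  `min_{A ≥ 0} rank_psd ≤ min rank` is PROVED (`exists_nonneg_sameSupport_hasPsdFactorization_rank`,
  Hadamard square); the direction `min rank ≤ min_{A ≥ 0} rank_psd` is the NAMED FACT
  `FawziEtAl2015_thm58`, DISCHARGED (`FawziEtAl2015_thm58_holds`, Lee–Theis' generic vectors
  `T(i,j) = ξ_iᵀA_iB_jη_j`: `exists_sameSupport_rank_le_of_psdFactorization`).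
* Corollary 5.9 (Gouveia–Robinson–Thomas: an `n`-dimensional polytope has `rank S_P = n+1 ≤
  rank_psd S_P`): NAMED FACT `FawziEtAl2015_cor59`.
* Corollary 5.13 (Gouveia–Parrilo–Thomas: a full-dimensional polytope in `ℝⁿ` whose slack matrix has
  psd rank `k` has at most `k^{O(k²n)}` facets): NAMED FACT `FawziEtAl2015_cor513`.
* Example 5.17 (Euclidean distance matrices `(i−j)²`: psd rank `≤ 2` PROVED,
  `hasPsdFactorization_euclideanDistanceMatrix_two`; nonnegative rank `≥ log₂ n` PROVED,
  `FawziEtAl2015_ex517_nonnegRank`).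

NOT typed here: Theorem 5.6 as a complexity statement (NP-hardness of `rank_√`; its reduction core —
Hadamard square roots of rank `≤ n` of the matrix built from a PARTITION instance `a_1,…,a_n` exist iff
`Σ ± a_i = 0` has a solution — and Remark 5.7 are PROVED in `PsdRankWorkedExamples.lean`:
`hasHadamardSqrtOfRankLE_partitionMatrix_iff`, `hasPsdFactorization_partitionMatrix_5_12_13`),
Theorems 5.10/5.11 (Renegar's hyperbolicity-cone description and quantifier-elimination bounds, cited
tools), Proposition 5.12 (degree of a convex set with a `S^k_+`-lift — filed with the lift vocabulary
of §3), Examples 5.14/5.15, Example 5.18 (prime square roots: PROVED in `PsdRankWorkedExamples.lean`,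
`le_of_hasHadamardSqrtOfRankLE_primeMatrix`), Problem 5.16 (an open problem, not literature), Table 1.
-/

noncomputable section

open Matrix Finset
open scoped MatrixOrder

namespace Literature.Combinatorics.Optimization

variable {ι κ : Type*}

/-! ### Tools: rank factorization and Hadamard squares (Theorem 2.9 (v), restated privately) -/

/-- Rank factorization through `ℝ^r` of a real matrix of rank `≤ r` (columns in a basis of the
column span, padded with zeros). [cite: FawziEtAl2015, Thm. 2.9 (v) proof (p07, rank factorization)] -/
private theorem exists_biFactorization_of_rank_le' [Fintype ι] [Fintype κ] (M : Matrix ι κ ℝ) {r : ℕ}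
    (hr : M.rank ≤ r) :
    ∃ (a : ι → Fin r → ℝ) (b : κ → Fin r → ℝ), ∀ i j, M i j = ∑ l, a i l * b j l := by
  classical
  let W : Submodule ℝ (ι → ℝ) := Submodule.span ℝ (Set.range M.col)
  let d := Module.finrank ℝ W
  have hd : d = M.rank := (rank_eq_finrank_span_cols M).symm
  let bW := Module.finBasis ℝ W
  have hmem : ∀ j, M.col j ∈ W := fun j => Submodule.subset_span ⟨j, rfl⟩
  have hdr : d ≤ r := hd ▸ hr
  let a : ι → Fin r → ℝ := fun i l => if h : (l : ℕ) < d then ((bW ⟨l, h⟩ : W) : ι → ℝ) i else 0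
  let b : κ → Fin r → ℝ := fun j l => if h : (l : ℕ) < d then bW.repr ⟨M.col j, hmem j⟩ ⟨l, h⟩ else 0
  refine ⟨a, b, fun i j => ?_⟩
  have hcol : (M.col j : ι → ℝ) = ∑ l : Fin d, bW.repr ⟨M.col j, hmem j⟩ l • ((bW l : W) : ι → ℝ) := by
    have h := bW.sum_repr ⟨M.col j, hmem j⟩
    have h' := congrArg (fun w : W => (w : ι → ℝ)) h
    simp only [Submodule.coe_sum, Submodule.coe_smul] at h'
    exact h'.symm
  have hij : M i j = ∑ l : Fin d, bW.repr ⟨M.col j, hmem j⟩ l * ((bW l : W) : ι → ℝ) i := by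
    have := congrFun hcol i
    simp only [Matrix.col_apply, Finset.sum_apply, Pi.smul_apply, smul_eq_mul] at this
    exact this
  rw [hij]
  let emb : Fin d ↪ Fin r := ⟨Fin.castLE hdr, Fin.castLE_injective hdr⟩
  have hsplit : ∑ l : Fin r, a i l * b j l = ∑ l ∈ (univ : Finset (Fin d)).map emb, a i l * b j l := by
    symm
    refine sum_subset (subset_univ _) fun l _ hl => ?_
    have hl' : ¬ (l : ℕ) < d := by
      intro hlt
      exact hl (Finset.mem_map.mpr ⟨⟨l, hlt⟩, mem_univ _, Fin.ext rfl⟩)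
    simp [a, hl']
  rw [hsplit, sum_map]
  refine sum_congr rfl fun l _ => ?_
  have hl : ((emb l : Fin r) : ℕ) < d := by simp [emb]
  have hlfin : (⟨((emb l : Fin r) : ℕ), hl⟩ : Fin d) = l := Fin.ext (by simp [emb])
  simp only [a, b, hl, dif_pos, hlfin]
  ring

/-- Hadamard square of an ordinary factorization through `ℝ^r` is a psd factorization of size `r`
(`⟨a aᵀ, b bᵀ⟩ = ⟨a,b⟩²`). [cite: FawziEtAl2015, Thm. 2.9 (v) proof (p07)] -/
private theorem hadamardSq_aux {M : ι → κ → ℝ} {r : ℕ} (a : ι → Fin r → ℝ) (b : κ → Fin r → ℝ)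
    (hM : ∀ i j, M i j = ∑ l, a i l * b j l) : HasPsdFactorization (fun i j => M i j ^ 2) r := by
  refine ⟨fun i => vecMulVec (a i) (a i), fun j => vecMulVec (b j) (b j),
    fun i => by simpa using posSemidef_vecMulVec_self_star (a i),
    fun j => by simpa using posSemidef_vecMulVec_self_star (b j), fun i j => ?_⟩
  change M i j ^ 2 = _
  rw [vecMulVec_mul_vecMulVec, trace_vecMulVec, dotProduct_smul, smul_eq_mul, hM i j, sq]
  simp only [dotProduct]

/-! ### Example 5.1: derangement matrices -/

/-- The `n × n` **derangement matrix** `D_n`: zeros on the diagonal, ones elsewhere (`rank D_n = n`).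
[cite: FawziEtAl2015, Ex. 2.6 (p05) and Ex. 5.1 (p14)] -/
def derangementMatrix (n : ℕ) : Matrix (Fin n) (Fin n) ℝ := fun i j => if i = j then 0 else 1

/-- Entries of the derangement matrix. [cite: FawziEtAl2015, Ex. 5.1 (p14)] -/
@[simp] theorem derangementMatrix_apply (n : ℕ) (i j : Fin n) :
    derangementMatrix n i j = if i = j then 0 else 1 := rfl

/-- **FGPRT Example 5.1** (p14, verbatim): "`rank_psd(D_n) = min{k : n ≤ C(k+1,2)}` for all `n`" (the
`n × n` derangement matrix makes the inequality `rank M ≤ C(rank_psd M + 1, 2)` tight: an explicit psd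
factorization of `D_{C(k+1,2)}` through `S^k_+`, submatrices for intermediate `n`, and Prop. 2.5 for
the lower bound). Typed: for `k ≥ 1` (sizes are positive integers in the source, §2), `D_n` has a
psd factorization of size `k` iff `n ≤ C(k+1, 2)`. [cite: FawziEtAl2015, Ex. 5.1 (p14)] -/
def FawziEtAl2015_ex51 : Prop :=
  ∀ n k : ℕ, 1 ≤ k → (HasPsdFactorization (derangementMatrix n) k ↔ n ≤ (k + 1).choose 2)

/-! ### Definition 5.2 and Corollary 5.3: square root rank -/

/-- **FGPRT Definition 5.2** (p14): "The square root rank of a nonnegative matrix `M`, denoted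
`rank_√(M)`, is the minimum rank of a Hadamard square root of `M`" (a Hadamard square root replaces
each entry by one of its two square roots). Typed as the predicate "`rank_√(M) ≤ r`": some real
matrix `N` with `N_{ij}² = M_{ij}` has rank `≤ r`. [cite: FawziEtAl2015, Def. 5.2 (p14)] -/
def HasHadamardSqrtOfRankLE [Fintype ι] [Fintype κ] (M : Matrix ι κ ℝ) (r : ℕ) : Prop :=
  ∃ N : Matrix ι κ ℝ, (∀ i j, N i j ^ 2 = M i j) ∧ N.rank ≤ r

/-- Unfolding of `HasHadamardSqrtOfRankLE`. [cite: FawziEtAl2015, Def. 5.2 (p14)] -/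
theorem hasHadamardSqrtOfRankLE_iff [Fintype ι] [Fintype κ] (M : Matrix ι κ ℝ) (r : ℕ) :
    HasHadamardSqrtOfRankLE M r ↔ ∃ N : Matrix ι κ ℝ, (∀ i j, N i j ^ 2 = M i j) ∧ N.rank ≤ r :=
  Iff.rfl

/-- "`rank_√(M) ≤ r`" is monotone in `r`. [cite: FawziEtAl2015, Def. 5.2 (p14)] -/
theorem HasHadamardSqrtOfRankLE.mono [Fintype ι] [Fintype κ] {M : Matrix ι κ ℝ} {r s : ℕ}
    (h : HasHadamardSqrtOfRankLE M r) (hrs : r ≤ s) : HasHadamardSqrtOfRankLE M s := by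
  obtain ⟨N, hN, hr⟩ := h
  exact ⟨N, hN, hr.trans hrs⟩

/-- **FGPRT Corollary 5.3** (p14, verbatim): "For a nonnegative matrix `M ∈ ℝ^{p×q}`, `rank_psd(M) ≤
rank_√(M)`" (if a Hadamard square root of `M` has rank `r` then `M` has a psd factorization of size `r`
by rank-one factors, Theorem 2.9 (v)). [cite: FawziEtAl2015, Cor. 5.3 (p14)] -/
theorem HasHadamardSqrtOfRankLE.hasPsdFactorization [Fintype ι] [Fintype κ] {M : Matrix ι κ ℝ}
    {r : ℕ} (h : HasHadamardSqrtOfRankLE M r) : HasPsdFactorization M r := by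
  obtain ⟨N, hN, hr⟩ := h
  obtain ⟨a, b, hab⟩ := exists_biFactorization_of_rank_le' N hr
  have hM : (fun i j => N i j ^ 2) = (M : ι → κ → ℝ) := funext fun i => funext fun j => hN i j
  rw [← hM]
  exact hadamardSq_aux a b hab

/-- **FGPRT Corollary 5.3, second part** (p14, verbatim): "In particular, if `M` is a `0/1` matrix,
then `rank_psd(M) ≤ rank(M)`" (a `0/1` matrix is its own Hadamard square root).
[cite: FawziEtAl2015, Cor. 5.3 (p14)] -/
theorem hasPsdFactorization_rank_of_zero_one [Fintype ι] [Fintype κ] (M : Matrix ι κ ℝ)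
    (h01 : ∀ i j, M i j = 0 ∨ M i j = 1) : HasPsdFactorization M M.rank := by
  refine HasHadamardSqrtOfRankLE.hasPsdFactorization ⟨M, fun i j => ?_, le_rfl⟩
  rcases h01 i j with h | h <;> simp [h]

/-! ### Lemma 5.4 and Corollary 5.5: Barvinok's bound -/

/-- **FGPRT Lemma 5.4** (Barvinok; p15, verbatim): "Let `A = (a_{ij})` be a real matrix and `f : ℝ → ℝ`
be a polynomial of degree `k`. If `B = (b_{ij})` is such that `b_{ij} = f(a_{ij})` for all `i,j`, then
`rank(B) ≤ C(k + rank(A), k)`." Typed with `natDegree f ≤ k` (equivalent, the bound being monotone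
in `k`). [cite: FawziEtAl2015, Lemma 5.4 (p15)] -/
def FawziEtAl2015_lemma54 : Prop :=
  ∀ (ι κ : Type) [Fintype ι] [Fintype κ] (A : Matrix ι κ ℝ) (f : Polynomial ℝ) (k : ℕ),
    f.natDegree ≤ k → (Matrix.of fun i j => f.eval (A i j)).rank ≤ (k + A.rank).choose k

/-- **FGPRT Corollary 5.5** (Barvinok; p15, verbatim): "If the number of distinct entries in a
nonnegative matrix `M` does not exceed `k`, then `rank_psd(M) ≤ C(k−1+rank(M), k−1)`" (interpolate
`√·` on the entry set by a polynomial of degree `k − 1`, then Lemma 5.4 and Corollary 5.3).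
[cite: FawziEtAl2015, Cor. 5.5 (p15)] -/
def FawziEtAl2015_cor55 : Prop :=
  ∀ (ι κ : Type) [Fintype ι] [Fintype κ] [DecidableEq ι] [DecidableEq κ] (M : Matrix ι κ ℝ) (k : ℕ),
    (∀ i j, 0 ≤ M i j) → (univ.image fun p : ι × κ => M p.1 p.2).card ≤ k →
      HasPsdFactorization M ((k - 1 + M.rank).choose (k - 1))

/-- **Corollary 5.5 from Lemma 5.4** — the printed proof: "Since `|𝓜| ≤ k`, there exists a polynomial
`f` of degree `k − 1` such that `φ(t) = f(t)` on `𝓜` [`φ` the square root]. Then by Lemma 5.4 and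
Corollary 5.3, `rank_psd(M) ≤ rank(√M) ≤ C(k−1+rank M, k−1)`" (Lagrange interpolation, Mathlib's
`Lagrange.interpolate`). [cite: FawziEtAl2015, Cor. 5.5 proof (p15)] -/
theorem FawziEtAl2015_cor55_of_lemma54 (h54 : FawziEtAl2015_lemma54) : FawziEtAl2015_cor55 := by
  intro ι κ _ _ _ _ M k hM hcard
  classical
  -- the set of entries and the interpolating polynomial of `√·` on it
  set E : Finset ℝ := univ.image fun p : ι × κ => M p.1 p.2 with hE
  have hmemE : ∀ i j, M i j ∈ E := fun i j => mem_image.mpr ⟨(i, j), mem_univ _, rfl⟩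
  rcases Nat.eq_zero_or_pos k with hk | hk
  · -- no entries at all: the matrix is empty
    subst hk
    have hEe : E = ∅ := card_eq_zero.mp (Nat.le_zero.mp hcard)
    refine ⟨fun _ => 0, fun _ => 0, fun _ => PosSemidef.zero, fun _ => PosSemidef.zero, fun i j => ?_⟩
    exact absurd (hEe ▸ hmemE i j) (Finset.notMem_empty _)
  let f : Polynomial ℝ := Lagrange.interpolate E id fun t => Real.sqrt t
  have hf_eval : ∀ t ∈ E, f.eval t = Real.sqrt t := fun t ht => by
    have := Lagrange.eval_interpolate_at_node (v := id) (fun t => Real.sqrt t)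
      (Set.injOn_id (E : Set ℝ)) ht
    simpa [f] using this
  have hf_deg : f.natDegree ≤ k - 1 := by
    have hlt := Lagrange.degree_interpolate_lt (v := id) (fun t => Real.sqrt t)
      (Set.injOn_id (E : Set ℝ))
    by_cases hf0 : f = 0
    · simp [hf0]
    · have hdeg : f.natDegree < E.card := by
        have h1 : (f.natDegree : WithBot ℕ) < E.card := by
          rw [← Polynomial.degree_eq_natDegree hf0]
          simpa [f] using hlt
        exact_mod_cast h1
      omega
  -- the square root matrix `N = f(M)` entrywise
  let N : Matrix ι κ ℝ := Matrix.of fun i j => f.eval (M i j)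
  have hN : ∀ i j, N i j ^ 2 = M i j := fun i j => by
    simp only [N, Matrix.of_apply, hf_eval _ (hmemE i j)]
    exact Real.sq_sqrt (hM i j)
  have hrank : N.rank ≤ (k - 1 + M.rank).choose (k - 1) := h54 ι κ M f (k - 1) hf_deg
  exact HasHadamardSqrtOfRankLE.hasPsdFactorization ⟨N, hN, hrank⟩

/-! ### Theorem 5.8: support-based bounds (Lee–Theis) -/

/-- **FGPRT Theorem 5.8, direction `min_{A ≥ 0, A ∈ 𝓜_Z} rank_psd(A) ≤ min_{A ∈ 𝓜_Z} rank(A)`** (p15;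
the observation preceding it: "the entry-wise square `M ∘ M` has the same support as `M` and has psd
rank bounded above by `rank(M)`"): for every real `A` there is an entrywise nonnegative `A'` with the
same support and a psd factorization of size `rank A`. [cite: FawziEtAl2015, Thm. 5.8 (p15)] -/
theorem exists_nonneg_sameSupport_hasPsdFactorization_rank [Fintype ι] [Fintype κ]
    (A : Matrix ι κ ℝ) : ∃ A' : Matrix ι κ ℝ, (∀ i j, 0 ≤ A' i j) ∧
      (∀ i j, A' i j = 0 ↔ A i j = 0) ∧ HasPsdFactorization A' A.rank := by
  obtain ⟨a, b, hab⟩ := exists_biFactorization_of_rank_le' A le_rfl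
  exact ⟨fun i j => A i j ^ 2, fun i j => sq_nonneg _, fun i j => sq_eq_zero_iff, hadamardSq_aux a b hab⟩

/-- **FGPRT Theorem 5.8** (Lee–Theis; p15, verbatim): "Fix a support `Z` and let `𝓜_Z` be the set of
all matrices sharing this support. Then `min_{A ∈ 𝓜_Z} rank(A) = min_{A ∈ 𝓜_Z, A ≥ 0} rank_psd(A)`."
The direction `≥` is `exists_nonneg_sameSupport_hasPsdFactorization_rank`; typed here is the
direction `≤`: an entrywise nonnegative matrix with a psd factorization of size `k` has a real
matrix of rank `≤ k` with the same support. [cite: FawziEtAl2015, Thm. 5.8 (p15)] -/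
def FawziEtAl2015_thm58 : Prop :=
  ∀ (ι κ : Type) [Fintype ι] [Fintype κ] (A' : Matrix ι κ ℝ) (k : ℕ), (∀ i j, 0 ≤ A' i j) →
    HasPsdFactorization A' k →
      ∃ A : Matrix ι κ ℝ, (∀ i j, A i j = 0 ↔ A' i j = 0) ∧ A.rank ≤ k

/-! ### Corollary 5.9 and Corollary 5.13: slack matrices of polytopes -/

/-- **FGPRT Corollary 5.9** (Gouveia–Robinson–Thomas; p15, verbatim): "If `P` is an `n`-dimensional
polytope with slack matrix `S_P`, then `rank(S_P) = n+1 ≤ rank_psd(S_P)`." Typed: `P =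
conv{x_1,…,x_v} = {y : a_j·y ≤ b_j, j < f} ⊆ ℝ^d` (the two descriptions of Definition 3.1, any such),
`dim P = n ≥ 1` (dimension of the direction space of the vertex set), slack matrix
`S_{ij} = b_j − a_j·x_i`: then `rank S = n + 1` and `S` has no psd factorization of size `≤ n`.
[cite: FawziEtAl2015, Cor. 5.9 (p15)] -/
def FawziEtAl2015_cor59 : Prop :=
  ∀ (d v f n : ℕ) (x : Fin v → (Fin d → ℝ)) (a : Fin f → (Fin d → ℝ)) (b : Fin f → ℝ),
    1 ≤ n → Module.finrank ℝ (vectorSpan ℝ (Set.range x)) = n →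
    convexHull ℝ (Set.range x) = {y | ∀ j, a j ⬝ᵥ y ≤ b j} →
      (Matrix.of fun i j => b j - a j ⬝ᵥ x i).rank = n + 1 ∧
        ∀ k ≤ n, ¬ HasPsdFactorization (fun i j => b j - a j ⬝ᵥ x i) k

/-- **FGPRT Corollary 5.13** (Gouveia–Parrilo–Thomas; p16, verbatim): "If `C ⊂ ℝⁿ` is a full-dimensional
polytope whose slack matrix has psd rank `k`, then `C` has at most `k^{O(k²n)}` facets" (Renegar's
quantifier elimination bounds the degree of the boundary of a projected spectrahedron, Prop. 5.12,
and the degree of a polytope is its number of facets). Typed with the unprinted `O`-constant as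
`∃ c > 0`: for `C = conv{x_i} = {y : a_j·y ≤ b_j, j < f}` full-dimensional in `ℝⁿ` with an IRREDUNDANT
inequality description (so `f` = number of facets) whose slack matrix has a psd factorization of
size `k`, `f ≤ k^{c k² n}`. [cite: FawziEtAl2015, Cor. 5.13 (p16)] -/
def FawziEtAl2015_cor513 : Prop :=
  ∃ c : ℝ, 0 < c ∧ ∀ (n v f k : ℕ) (x : Fin v → (Fin n → ℝ)) (a : Fin f → (Fin n → ℝ)) (b : Fin f → ℝ),
    (interior (convexHull ℝ (Set.range x))).Nonempty →
    convexHull ℝ (Set.range x) = {y | ∀ j, a j ⬝ᵥ y ≤ b j} →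
    (∀ j₀, {y : Fin n → ℝ | ∀ j, j ≠ j₀ → a j ⬝ᵥ y ≤ b j} ≠ {y | ∀ j, a j ⬝ᵥ y ≤ b j}) →
    HasPsdFactorization (fun i j => b j - a j ⬝ᵥ x i) k →
      (f : ℝ) ≤ (k : ℝ) ^ (c * (k : ℝ) ^ 2 * n)

/-! ### Example 5.17: Euclidean distance matrices -/

/-- **FGPRT Example 5.17** (p17): the Euclidean distance matrix `M_n(i,j) = (i−j)²` has psd rank (and
square root rank) at most `2` for every `n`, "since the matrix with `(i,j)`-entry equal to `i−j` has
usual rank two": `i − j = ⟨(i,1), (1,−j)⟩`. [cite: FawziEtAl2015, Ex. 5.17 (p17)] -/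
theorem hasPsdFactorization_euclideanDistanceMatrix_two (n : ℕ) :
    HasPsdFactorization (fun i j : Fin n => (((i : ℕ) : ℝ) - j) ^ 2) 2 := by
  refine hadamardSq_aux (M := fun i j : Fin n => (((i : ℕ) : ℝ) - j)) (fun i => ![((i : ℕ) : ℝ), 1])
    (fun j => ![(1 : ℝ), -((j : ℕ) : ℝ)]) fun i j => ?_
  simp [Fin.sum_univ_two]
  ring

/-- **FGPRT Example 5.17** (p17, verbatim): the Euclidean distance matrix `M_n` "has growing nonnegative
rank. Suppose `M_n` has a `ℝ^k_+`-factorization … all the `b_i`'s must have supports that are pairwise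
incomparable. Since there are at most `2^k` possibilities for these supports, `n ≤ 2^k`, or
equivalently, `k ≥ log₂ n`." Typed: a nonnegative factorization of `((i−j)²)_{i,j<n}` through `ℝ^k`
forces `n ≤ 2^k`. [cite: FawziEtAl2015, Ex. 5.17 (p17)] -/
theorem FawziEtAl2015_ex517_nonnegRank (n k : ℕ) (U : Fin n → Fin k → ℝ) (V : Fin k → Fin n → ℝ)
    (hU : ∀ i l, 0 ≤ U i l) (hV : ∀ l j, 0 ≤ V l j)
    (hM : ∀ i j : Fin n, (((i : ℕ) : ℝ) - j) ^ 2 = ∑ l, U i l * V l j) : n ≤ 2 ^ k := by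
  classical
  -- support of column `j` of `V`
  let supp : Fin n → Finset (Fin k) := fun j => univ.filter fun l => V l j ≠ 0
  -- if `supp j ⊆ supp i` then `M i j = 0`, since `M i i = 0` kills `U i` on `supp i`
  have hkey : ∀ i j, supp j ⊆ supp i → (((i : ℕ) : ℝ) - j) ^ 2 = 0 := by
    intro i j hsub
    have hdiag : ∑ l, U i l * V l i = 0 := by rw [← hM i i]; simp
    have hUl : ∀ l, V l i ≠ 0 → U i l = 0 := by
      intro l hl
      have hterm := (sum_eq_zero_iff_of_nonneg fun l _ => mul_nonneg (hU i l) (hV l i)).mp hdiag l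
        (mem_univ l)
      rcases mul_eq_zero.mp hterm with h | h
      · exact h
      · exact absurd h hl
    rw [hM i j]
    refine sum_eq_zero fun l _ => ?_
    by_cases hl : V l j = 0
    · rw [hl, mul_zero]
    · have hli : l ∈ supp i := hsub (by simp [supp, hl])
      have : V l i ≠ 0 := by simpa [supp] using hli
      rw [hUl l this, zero_mul]
  -- hence `supp` is injective
  have hinj : Function.Injective supp := by
    intro i j hij
    have h := hkey i j (hij ▸ Finset.Subset.refl _)
    have : ((i : ℕ) : ℝ) = j := by
      have := (pow_eq_zero_iff (n := 2) (by norm_num)).mp h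
      linarith
    exact Fin.ext (by exact_mod_cast this)
  have := Fintype.card_le_of_injective supp hinj
  simpa [Fintype.card_finset] using this

/-! ### Discharge of `FawziEtAl2015_lemma54` (Barvinok): ranks of entrywise polynomial images -/

section Barvinok

variable {ι κ : Type} [Fintype κ]

/-- Hadamard powers: if `A_{ij} = Σ_{l<r} a_{il} b_{jl}` then `c · A^{∘m}` factors through the multisets
of size `m` from `r` symbols (`(Σ_l a_l b_l)^m = Σ_f Π_p a_{f(p)} b_{f(p)}`, grouped by the multiset of
`f`), so `rank(c · A^{∘m}) ≤ C(r+m−1, m)` (Barvinok's symmetric-tensor count).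
[cite: FawziEtAl2015, Lemma 5.4 proof sketch (p15, [Barvinok])] -/
private theorem rank_hadamardPow_le {r : ℕ} (A : Matrix ι κ ℝ) (a : ι → Fin r → ℝ)
    (b : κ → Fin r → ℝ) (hab : ∀ i j, A i j = ∑ l, a i l * b j l) (c : ℝ) (m : ℕ) :
    (Matrix.of fun i j => c * A i j ^ m).rank ≤ (r + m - 1).choose m := by
  classical
  let μ : (Fin m → Fin r) → Sym (Fin r) m := fun f =>
    ⟨(univ : Finset (Fin m)).val.map f, by simp⟩
  let U : Matrix ι (Sym (Fin r) m) ℝ := fun i s =>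
    c * (((univ : Finset (Fin m → Fin r)).filter (fun f => μ f = s)).card * (s.1.map (a i)).prod)
  let V : Matrix (Sym (Fin r) m) κ ℝ := fun s j => (s.1.map (b j)).prod
  have hfac : (Matrix.of fun i j => c * A i j ^ m) = U * V := by
    ext i j
    rw [of_apply, hab i j, Matrix.mul_apply]
    have hpow : (∑ l, a i l * b j l) ^ m = ∏ _p : Fin m, ∑ l, a i l * b j l := by
      rw [prod_const, card_univ, Fintype.card_fin]
    rw [hpow, Finset.prod_univ_sum, Fintype.piFinset_univ, ← Finset.sum_fiberwise univ μ, mul_sum]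
    refine sum_congr rfl fun s _ => ?_
    have hconst : ∀ f ∈ univ.filter (fun f => μ f = s),
        ∏ p, a i (f p) * b j (f p) = (s.1.map (a i)).prod * (s.1.map (b j)).prod := by
      intro f hf
      have hs : (univ : Finset (Fin m)).val.map f = s.1 := congrArg Subtype.val (mem_filter.mp hf).2
      rw [prod_mul_distrib, Finset.prod_eq_multiset_prod, Finset.prod_eq_multiset_prod, ← hs,
        Multiset.map_map, Multiset.map_map]
      rfl
    rw [Finset.sum_congr rfl hconst, Finset.sum_const, nsmul_eq_mul]
    simp only [U, V]
    ring
  calc (Matrix.of fun i j => c * A i j ^ m).rank = (U * V).rank := by rw [hfac]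
    _ ≤ U.rank := Matrix.rank_mul_le_left _ _
    _ ≤ Fintype.card (Sym (Fin r) m) := Matrix.rank_le_card_width _
    _ = (r + m - 1).choose m := by
        rw [Sym.card_sym_eq_multichoose, Fintype.card_fin, Nat.multichoose_eq]

/-- Subadditivity of `Matrix.rank` (over a field). [folklore] -/
private theorem rank_add_le_aux (A B : Matrix ι κ ℝ) : (A + B).rank ≤ A.rank + B.rank := by
  unfold Matrix.rank
  rw [Matrix.mulVecLin_add]
  calc Module.finrank ℝ (LinearMap.range (A.mulVecLin + B.mulVecLin))
      ≤ Module.finrank ℝ ↥(LinearMap.range A.mulVecLin ⊔ LinearMap.range B.mulVecLin) := by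
        apply Submodule.finrank_mono
        rintro _ ⟨v, rfl⟩
        exact Submodule.add_mem_sup ⟨v, rfl⟩ ⟨v, rfl⟩
    _ ≤ _ := Submodule.finrank_add_le_finrank_add_finrank _ _

/-- Rank is subadditive over finite sums. [folklore] -/
private theorem rank_sum_le (s : Finset ℕ) (N : ℕ → Matrix ι κ ℝ) :
    (∑ m ∈ s, N m).rank ≤ ∑ m ∈ s, (N m).rank := by
  classical
  induction s using Finset.induction_on with
  | empty => simp
  | insert x s hx ih =>
      rw [sum_insert hx, sum_insert hx]
      exact (rank_add_le_aux _ _).trans (Nat.add_le_add_left ih _)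

/-- `Σ_{m=0}^{k} C(r+m−1, m) = C(r+k, k)` (parallel summation). [folklore] -/
private theorem sum_range_choose_multichoose (r k : ℕ) :
    ∑ m ∈ range (k + 1), (r + m - 1).choose m = (r + k).choose k := by
  induction k with
  | zero => simp
  | succ k ih =>
      rw [sum_range_succ, ih, show r + (k + 1) - 1 = r + k by omega,
        show r + (k + 1) = (r + k) + 1 by omega, Nat.choose_succ_succ, add_comm]

end Barvinok

/-- **Discharge of `FawziEtAl2015_lemma54`** (Barvinok's lemma): `rank(f∘A) ≤ C(deg f + rank A, deg f)`:
`f∘A = Σ_m c_m A^{∘m}` with `rank A^{∘m} ≤ C(rank A + m − 1, m)` (Hadamard powers of a rank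
factorization factor through size-`m` multisets) and `Σ_{m ≤ k} C(r+m−1, m) = C(r+k, k)`.
[cite: FawziEtAl2015, Lemma 5.4 (p15)] -/
theorem FawziEtAl2015_lemma54_holds : FawziEtAl2015_lemma54 := by
  intro ι κ _ _ A f k hdeg
  classical
  obtain ⟨a, b, hab⟩ := exists_biFactorization_of_rank_le A le_rfl
  have hB : (Matrix.of fun i j => f.eval (A i j)) =
      ∑ m ∈ range (f.natDegree + 1), Matrix.of fun i j => f.coeff m * A i j ^ m := by
    ext i j
    rw [of_apply, Polynomial.eval_eq_sum_range, Matrix.sum_apply]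
    rfl
  rw [hB]
  calc (∑ m ∈ range (f.natDegree + 1), Matrix.of fun i j => f.coeff m * A i j ^ m).rank
      ≤ ∑ m ∈ range (f.natDegree + 1), (Matrix.of fun i j => f.coeff m * A i j ^ m).rank :=
        rank_sum_le _ _
    _ ≤ ∑ m ∈ range (f.natDegree + 1), (A.rank + m - 1).choose m :=
        sum_le_sum fun m _ => rank_hadamardPow_le A a b hab (f.coeff m) m
    _ ≤ ∑ m ∈ range (k + 1), (A.rank + m - 1).choose m :=
        sum_le_sum_of_subset (range_subset_range.mpr (by omega))
    _ = (A.rank + k).choose k := sum_range_choose_multichoose _ _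
    _ = (k + A.rank).choose k := by rw [add_comm]

/-- **Discharge of `FawziEtAl2015_cor55`** (Barvinok's bound on the psd rank by the number of distinct
entries), from Lemma 5.4 through the proved reduction `FawziEtAl2015_cor55_of_lemma54` (Lagrange
interpolation of `√·` on the entry set + Corollary 5.3). [cite: FawziEtAl2015, Cor. 5.5 (p15)] -/
theorem FawziEtAl2015_cor55_holds : FawziEtAl2015_cor55 :=
  FawziEtAl2015_cor55_of_lemma54 FawziEtAl2015_lemma54_holds

/-! ### Discharge of `FawziEtAl2015_ex51`: the explicit factorization of `D_{C(k+1,2)}` -/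

section Ex51

variable {k : ℕ}

/-- `Tr(v vᵀ · ½(diag d + c cᵀ + e eᵀ)) = ½ (Σ_a d_a v_a² + ⟨v,c⟩² + ⟨v,e⟩²)` — the pairing of the
rank-one row factors with the column factors of Example 5.1. [cite: FawziEtAl2015, Ex. 5.1 (p14)] -/
private theorem trace_vecMulVec_mul_half_sum (v d c e : Fin k → ℝ) :
    (vecMulVec v v * ((1 / 2 : ℝ) • (diagonal d + vecMulVec c c + vecMulVec e e))).trace =
      1 / 2 * (∑ a, d a * v a * v a + (v ⬝ᵥ c) ^ 2 + (v ⬝ᵥ e) ^ 2) := by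
  have hcc : ∀ w : Fin k → ℝ, v ⬝ᵥ (v ᵥ* vecMulVec w w) = (v ⬝ᵥ w) ^ 2 := by
    intro w
    have h1 : v ᵥ* vecMulVec w w = (v ⬝ᵥ w) • w := by
      ext a
      simp only [vecMul, dotProduct, vecMulVec_apply, Pi.smul_apply, smul_eq_mul, Finset.sum_mul]
      exact Finset.sum_congr rfl fun b _ => by ring
    rw [h1, dotProduct_smul, smul_eq_mul, sq]
  have hdd : v ⬝ᵥ (v ᵥ* diagonal d) = ∑ a, d a * v a * v a := by
    simp only [dotProduct, vecMul_diagonal]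
    exact Finset.sum_congr rfl fun a _ => by ring
  rw [vecMulVec_mul, trace_vecMulVec, Matrix.vecMul_smul, dotProduct_smul, smul_eq_mul,
    Matrix.vecMul_add, Matrix.vecMul_add, dotProduct_add, dotProduct_add, hcc, hcc, hdd]

/-- **FGPRT Example 5.1, the construction** (p14): on the `C(k+1,2)` indices `{(s,t) : s ≤ t}` (the
diagonal positions `s = t` and the pairs `s < t` of `[k]`), the matrix with zero diagonal and ones
elsewhere has the psd factorization of size `k` given by `A_{ss} = e_se_sᵀ`, `A_{st} = F_{s,t} =
(e_s−e_t)(e_s−e_t)ᵀ` and the printed `B`'s (`B_{uu}` = `E` = ones on the diagonal, `½` elsewhere, with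
row and column `u` zeroed; `B_{uw}` = ones on the diagonal and at `(u,w),(w,u)`, `½` elsewhere), here
written as `½(diag + c cᵀ + e eᵀ)` to make positive semidefiniteness evident.
[cite: FawziEtAl2015, Ex. 5.1 (p14)] -/
theorem hasPsdFactorization_derangement_pairsLE (k : ℕ) :
    HasPsdFactorization
      (fun p q : {p : Fin k × Fin k // p.1 ≤ p.2} => if p = q then (0 : ℝ) else 1) k := by
  classical
  -- row factors `A_{st} = v vᵀ`, `v = e_s − e_t` (`s < t`), `v = e_s` (`s = t`)
  let v : {p : Fin k × Fin k // p.1 ≤ p.2} → Fin k → ℝ := fun p a =>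
    (if a = p.1.1 then 1 else 0) - (if p.1.1 = p.1.2 then 0 else if a = p.1.2 then 1 else 0)
  -- column factors `B_{uw} = ½ (diag d + c cᵀ + e eᵀ)`
  let d : {p : Fin k × Fin k // p.1 ≤ p.2} → Fin k → ℝ := fun q a =>
    if a = q.1.1 ∨ a = q.1.2 then 0 else 1
  let c : {p : Fin k × Fin k // p.1 ≤ p.2} → Fin k → ℝ := fun q a =>
    if q.1.1 = q.1.2 then 1 - (if a = q.1.1 then 1 else 0)
    else (if a = q.1.1 then 1 else 0) + (if a = q.1.2 then 1 else 0)
  let e : {p : Fin k × Fin k // p.1 ≤ p.2} → Fin k → ℝ := fun q _ =>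
    if q.1.1 = q.1.2 then 0 else 1
  refine ⟨fun p => vecMulVec (v p) (v p),
    fun q => (1 / 2 : ℝ) • (diagonal (d q) + vecMulVec (c q) (c q) + vecMulVec (e q) (e q)),
    fun p => by simpa using posSemidef_vecMulVec_self_star (v p), fun q => ?_, fun p q => ?_⟩
  · refine PosSemidef.smul ?_ (by norm_num)
    refine PosSemidef.add (PosSemidef.add ?_ ?_) ?_
    · exact posSemidef_diagonal_iff.mpr fun a => by dsimp only [d]; split_ifs <;> norm_num
    · simpa using posSemidef_vecMulVec_self_star (c q)
    · simpa using posSemidef_vecMulVec_self_star (e q)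
  · change (if p = q then (0 : ℝ) else 1) = _
    rw [trace_vecMulVec_mul_half_sum (v p) (d q) (c q) (e q)]
    obtain ⟨⟨s, t⟩, hst⟩ := p
    obtain ⟨⟨u, w⟩, huw⟩ := q
    simp only [Subtype.mk.injEq, Prod.mk.injEq, v, d, c, e, dotProduct]
    change s ≤ t at hst
    change u ≤ w at huw
    by_cases hst' : s = t <;> by_cases huw' : u = w
    · -- `p = (s,s)`, `q = (u,u)`: value `[s ≠ u]`
      subst hst' huw'
      by_cases hsu : s = u
      · subst hsu; simp [Finset.sum_ite_eq', Finset.sum_sub_distrib, mul_sub, mul_ite]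
      · have hus : ¬ u = s := fun h => hsu h.symm
        simp [Finset.sum_ite_eq', Finset.sum_sub_distrib, mul_sub, mul_ite, hsu, hus]
        norm_num
    · -- `p = (s,s)`, `q = (u,w)`, `u ≠ w`: value `1`
      subst hst'
      have hwu : ¬ w = u := fun h => huw' h.symm
      simp only [huw', if_false]
      by_cases hsu : s = u
      · subst hsu
        simp [Finset.sum_ite_eq', Finset.sum_add_distrib, mul_add, mul_ite, huw', hwu]
        norm_num
      · have hus : ¬ u = s := fun h => hsu h.symm
        by_cases hsw : s = w
        · subst hsw
          simp [Finset.sum_ite_eq', Finset.sum_add_distrib, mul_add, mul_ite, hsu, hus]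
          norm_num
        · have hws : ¬ w = s := fun h => hsw h.symm
          simp [Finset.sum_ite_eq', Finset.sum_add_distrib, mul_add, mul_ite, hsu, hus,
            hsw, hws]
          norm_num
    · -- `p = (s,t)`, `s ≠ t`, `q = (u,u)`: value `1`
      subst huw'
      simp only [hst', if_false]
      have hts : ¬ t = s := fun h => hst' h.symm
      by_cases hsu : s = u
      · subst hsu
        simp [Finset.sum_ite_eq', Finset.sum_sub_distrib, mul_sub, 
          mul_add, mul_ite, hst', hts]
        norm_num
      · have hus : ¬ u = s := fun h => hsu h.symm
        by_cases htu : t = u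
        · subst htu
          simp [Finset.sum_ite_eq', Finset.sum_sub_distrib, mul_sub, 
            mul_add, mul_ite, hst', hts]
          norm_num
        · have hut : ¬ u = t := fun h => htu h.symm
          simp [Finset.sum_ite_eq', Finset.sum_sub_distrib, mul_sub, 
            mul_add, mul_ite, hst', hts, hsu, hus, htu, hut]
          norm_num
    · -- `p = (s,t)`, `s < t`, `q = (u,w)`, `u < w`: value `[p ≠ q]`
      simp only [hst', huw', if_false]
      have hts : ¬ t = s := fun h => hst' h.symm
      have hwu : ¬ w = u := fun h => huw' h.symm
      by_cases hsu : s = u <;> by_cases hsw : s = w <;> by_cases htu : t = u <;> by_cases htw : t = w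
      · exact absurd (hsu.symm.trans hsw) huw'
      · exact absurd (hsu.symm.trans hsw) huw'
      · exact absurd (hsu.symm.trans hsw) huw'
      · exact absurd (hsu.symm.trans hsw) huw'
      · exact absurd (hsu.trans htu.symm) hst'
      · exact absurd (hsu.trans htu.symm) hst'
      · -- `p = q`
        subst hsu htw
        simp [Finset.sum_ite_eq', Finset.sum_sub_distrib, Finset.sum_add_distrib, mul_sub, 
          mul_add, mul_ite, hst', hts]
      · subst hsu
        have hws : ¬ w = s := fun h => hsw h.symm
        have hwt : ¬ w = t := fun h => htw h.symm
        simp [Finset.sum_ite_eq', Finset.sum_sub_distrib, Finset.sum_add_distrib, mul_sub, 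
          mul_add, mul_ite, hst', hts, hsw, hws, htw, hwt]
        norm_num
      · exact absurd (htu.symm.trans htw) huw'
      · exact absurd (le_antisymm hst (by rw [hsw, htu]; exact huw)) hst'
      · exact absurd (hsw.trans htw.symm) hst'
      · subst hsw
        have hus : ¬ u = s := fun h => hsu h.symm
        have hut : ¬ u = t := fun h => htu h.symm
        have htw' : ¬ t = s := hts
        simp [Finset.sum_ite_eq', Finset.sum_sub_distrib, Finset.sum_add_distrib, mul_sub, 
          mul_add, mul_ite, hst', hts, hsu, hus, htu, hut]
        norm_num
      · exact absurd (htu.symm.trans htw) huw'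
      · subst htu
        have hus : ¬ t = s := hts
        have hws : ¬ w = s := fun h => hsw h.symm
        have hwt : ¬ w = t := fun h => htw h.symm
        simp [Finset.sum_ite_eq', Finset.sum_sub_distrib, Finset.sum_add_distrib, mul_sub, 
          mul_add, mul_ite, hst', hts, hsw, hws, htw, hwt]
        norm_num
      · subst htw
        have hus : ¬ u = s := fun h => hsu h.symm
        have hut : ¬ u = t := fun h => htu h.symm
        have hts' : ¬ t = s := hts
        simp [Finset.sum_ite_eq', Finset.sum_sub_distrib, Finset.sum_add_distrib, mul_sub, 
          mul_add, mul_ite, hst', hts, hsu, hus, htu, hut]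
        norm_num
      · have hus : ¬ u = s := fun h => hsu h.symm
        have hut : ¬ u = t := fun h => htu h.symm
        have hws : ¬ w = s := fun h => hsw h.symm
        have hwt : ¬ w = t := fun h => htw h.symm
        simp [Finset.sum_ite_eq', Finset.sum_sub_distrib, Finset.sum_add_distrib, mul_sub, 
          mul_add, mul_ite, hst', hts, hsu, hus, htu, hut, hsw, hws, htw, hwt]
        norm_num


/-- `D_n = J − I`. [cite: FawziEtAl2015, Ex. 5.1 (p14)] -/
private theorem derangementMatrix_eq_of_sub_one (n : ℕ) :
    derangementMatrix n = Matrix.of (fun _ _ : Fin n => (1 : ℝ)) - 1 := by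
  ext i j
  by_cases h : i = j <;> simp [derangementMatrix, h]

/-- "It verifies `rank(D_n) = n` for all `n`" (p14): for `n ≥ 2`, `D_n · (J/(n−1) − I) = I`, so `D_n`
is invertible (`D_1 = 0` has rank `0`). [cite: FawziEtAl2015, Ex. 5.1 (p14)] -/
theorem rank_derangementMatrix {n : ℕ} (hn : 2 ≤ n) : (derangementMatrix n).rank = n := by
  classical
  have hn1 : ((n : ℝ) - 1) ≠ 0 := by
    have : (2 : ℝ) ≤ n := by exact_mod_cast hn
    intro h
    linarith
  have hJJ : Matrix.of (fun _ _ : Fin n => (1 : ℝ)) * Matrix.of (fun _ _ : Fin n => (1 : ℝ)) =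
      (n : ℝ) • Matrix.of (fun _ _ : Fin n => (1 : ℝ)) := by
    ext i j
    simp [Matrix.mul_apply]
  have hinv : derangementMatrix n * ((((n : ℝ) - 1)⁻¹) • Matrix.of (fun _ _ : Fin n => (1 : ℝ)) - 1) = 1 := by
    rw [derangementMatrix_eq_of_sub_one, Matrix.sub_mul, Matrix.mul_sub, Matrix.mul_sub, Matrix.one_mul,
      Matrix.one_mul, Matrix.mul_one, Matrix.mul_smul, hJJ, smul_smul]
    have hc : ((n : ℝ) - 1)⁻¹ * n = 1 + ((n : ℝ) - 1)⁻¹ := by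
      field_simp
      ring
    rw [hc, add_smul, one_smul]
    abel
  rw [Matrix.rank_of_isUnit _ (IsUnit.of_mul_eq_one _ hinv), Fintype.card_fin]

/-- **Discharge of `FawziEtAl2015_ex51`** (Example 5.1: `rank_psd(D_n) = min{k : n ≤ C(k+1,2)}`):
`⇐` by the explicit factorization of `D_{C(k+1,2)}` (`hasPsdFactorization_derangement_pairsLE`, on the
`C(k+1,2) = |{s ≤ t}|` indices) and "`D_n` is a submatrix of `D_{C(k+1,2)}`"; `⇒` by Proposition 2.5
(`rank D_n = n ≤ C(k+1,2)`, `HasPsdFactorization.rank_le_choose`; `n ≤ 1 ≤ C(k+1,2)` directly for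
`k ≥ 1`). [cite: FawziEtAl2015, Ex. 5.1 (p14)] -/
theorem FawziEtAl2015_ex51_holds : FawziEtAl2015_ex51 := by
  intro n k hk
  classical
  have hcard : Fintype.card {p : Fin k × Fin k // p.1 ≤ p.2} = (k + 1).choose 2 := by
    rw [← Fintype.card_congr (Sym2.sortEquiv (α := Fin k)), Sym2.card, Fintype.card_fin]
  constructor
  · intro h
    rcases Nat.lt_or_ge n 2 with hn | hn
    · have h1 : 1 ≤ (k + 1).choose 2 := Nat.succ_le_of_lt (Nat.choose_pos (by omega))
      omega
    · have hr := HasPsdFactorization.rank_le_choose (M := derangementMatrix n) h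
      rwa [rank_derangementMatrix hn] at hr
  · intro hn
    rw [← hcard] at hn
    -- `D_n` is the submatrix of `D_{C(k+1,2)}` on any `n` of the `C(k+1,2)` indices
    let f : Fin n → {p : Fin k × Fin k // p.1 ≤ p.2} :=
      fun i => (Fintype.equivFin {p : Fin k × Fin k // p.1 ≤ p.2}).symm (Fin.castLE hn i)
    have hf : Function.Injective f :=
      (Fintype.equivFin _).symm.injective.comp (Fin.castLE_injective hn)
    have hsub := (hasPsdFactorization_derangement_pairsLE k).submatrix f f
    have hD : (derangementMatrix n : Fin n → Fin n → ℝ) =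
        fun i j => if f i = f j then (0 : ℝ) else 1 := by
      funext i j
      simp only [derangementMatrix, hf.eq_iff]
    rw [hD]
    exact hsub

end Ex51

/-! ### Discharge of `FawziEtAl2015_thm58`: Lee–Theis' generic-vector realisation of the support -/

section Thm58

/-- **Lee–Theis' support lemma** ([Lee–Theis 2012, Lemma 13 and the proof of Lemma 8]; the proof
behind FGPRT Theorem 5.8): for a psd factorization `S(i,j) = Tr(A_i B_j)` of size `k`, the matrix
`T(i,j) = ξ_iᵀ A_i B_j η_j` has the same support as `S` for generic vectors `ξ_i, η_j ∈ ℝ^k` (the bad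
set is a finite union of proper subvarieties, `A_i B_j ≠ 0` whenever `Tr(A_i B_j) ≠ 0`; genericity is
realised here by a nonzero value of the product polynomial, `MvPolynomial.funext` over the infinite
field `ℝ`), and `T` has rank `≤ k` (it factors through `ℝ^k`).
[cite: FawziEtAl2015, Thm. 5.8 (p15)] -/
theorem exists_sameSupport_rank_le_of_psdFactorization {ι κ : Type} [Fintype ι] [Fintype κ] {k : ℕ}
    {S : Matrix ι κ ℝ} (A : ι → Matrix (Fin k) (Fin k) ℝ) (B : κ → Matrix (Fin k) (Fin k) ℝ)
    (hA : ∀ i, (A i).PosSemidef) (hB : ∀ j, (B j).PosSemidef) (hS : ∀ i j, S i j = (A i * B j).trace) :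
    ∃ (ξ : ι → Fin k → ℝ) (η : κ → Fin k → ℝ),
      ∀ i j, ξ i ⬝ᵥ ((A i * B j) *ᵥ η j) = 0 ↔ S i j = 0 := by
  classical
  -- one variable per coordinate of each `ξ_i` and each `η_j`
  let b : ι → κ → MvPolynomial ((ι × Fin k) ⊕ (κ × Fin k)) ℝ := fun i j =>
    ∑ s, ∑ t, MvPolynomial.C ((A i * B j) s t) * MvPolynomial.X (Sum.inl (i, s)) *
      MvPolynomial.X (Sum.inr (j, t))
  have heval : ∀ i j (x : (ι × Fin k) ⊕ (κ × Fin k) → ℝ), MvPolynomial.eval x (b i j) =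
      ∑ s, ∑ t, (A i * B j) s t * x (Sum.inl (i, s)) * x (Sum.inr (j, t)) := by
    intro i j x
    simp only [b, map_sum, map_mul, MvPolynomial.eval_C, MvPolynomial.eval_X]
  -- the pairing `ξᵀ (A B) η` is the evaluation of `b`
  have hpair : ∀ i j (x : (ι × Fin k) ⊕ (κ × Fin k) → ℝ),
      (fun s => x (Sum.inl (i, s))) ⬝ᵥ ((A i * B j) *ᵥ fun t => x (Sum.inr (j, t))) =
        MvPolynomial.eval x (b i j) := by
    intro i j x
    rw [heval]
    simp only [dotProduct, mulVec, Finset.mul_sum]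
    exact sum_congr rfl fun s _ => sum_congr rfl fun t _ => by ring
  -- each `b i j` with `S i j ≠ 0` is a nonzero polynomial
  set supp : Finset (ι × κ) := univ.filter fun p => S p.1 p.2 ≠ 0 with hsupp
  have hb_ne : ∀ p ∈ supp, b p.1 p.2 ≠ 0 := by
    intro p hp hzero
    have hne : S p.1 p.2 ≠ 0 := (mem_filter.mp hp).2
    have hC : A p.1 * B p.2 ≠ 0 := fun h => hne (by rw [hS, h, trace_zero])
    obtain ⟨s, t, hst⟩ : ∃ s t, (A p.1 * B p.2) s t ≠ 0 := by
      by_contra h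
      push Not at h
      exact hC (Matrix.ext fun s t => by rw [h s t]; rfl)
    -- evaluate at the indicator point `ξ_{p.1} = e_s`, `η_{p.2} = e_t`
    let x : (ι × Fin k) ⊕ (κ × Fin k) → ℝ :=
      Sum.elim (fun a => if a = (p.1, s) then 1 else 0) (fun c => if c = (p.2, t) then 1 else 0)
    have hx := heval p.1 p.2 x
    rw [hzero, map_zero] at hx
    apply hst
    rw [hx]
    simp only [x, Sum.elim_inl, Sum.elim_inr, Prod.mk.injEq, true_and, mul_ite, mul_one, mul_zero,
      Finset.sum_ite_eq', Finset.mem_univ, if_true]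
  -- a common non-root of all of them
  have hP : ∏ p ∈ supp, b p.1 p.2 ≠ 0 := Finset.prod_ne_zero_iff.mpr hb_ne
  obtain ⟨x, hx⟩ : ∃ x, MvPolynomial.eval x (∏ p ∈ supp, b p.1 p.2) ≠ 0 := by
    by_contra h
    push Not at h
    exact hP (MvPolynomial.funext fun x => by rw [h x, map_zero])
  rw [map_prod] at hx
  have hxb : ∀ p ∈ supp, MvPolynomial.eval x (b p.1 p.2) ≠ 0 := fun p hp =>
    (Finset.prod_ne_zero_iff.mp hx) p hp
  refine ⟨fun i s => x (Sum.inl (i, s)), fun j t => x (Sum.inr (j, t)), fun i j => ?_⟩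
  rw [hpair]
  constructor
  · intro h0
    by_contra hne
    exact hxb (i, j) (mem_filter.mpr ⟨mem_univ _, hne⟩) h0
  · intro h0
    have hAB : A i * B j = 0 :=
      mul_eq_zero_of_posSemidef_trace_eq_zero (hA i) (hB j) (by rw [← hS]; exact h0)
    rw [heval]
    simp [hAB]

/-- **Discharge of `FawziEtAl2015_thm58`** (Theorem 5.8, Lee–Theis: `min_{A ∈ 𝓜_Z} rank A ≤
min_{A ∈ 𝓜_Z, A ≥ 0} rank_psd A`): a matrix with a psd factorization of size `k` has a real matrix
of rank `≤ k` with the same support, `T(i,j) = ξ_iᵀ A_i B_j η_j = ⟨A_i ξ_i, B_j η_j⟩`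
(`exists_sameSupport_rank_le_of_psdFactorization`), which factors through `ℝ^k`. (Nonnegativity of
the matrix is not used.) [cite: FawziEtAl2015, Thm. 5.8 (p15)] -/
theorem FawziEtAl2015_thm58_holds : FawziEtAl2015_thm58 := by
  intro ι κ _ _ A' k _ hfac
  classical
  obtain ⟨A, B, hA, hB, hM⟩ := hfac
  obtain ⟨ξ, η, hsupp⟩ := exists_sameSupport_rank_le_of_psdFactorization (S := A') A B hA hB hM
  refine ⟨Matrix.of fun i j => ξ i ⬝ᵥ ((A i * B j) *ᵥ η j), fun i j => hsupp i j, ?_⟩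
  -- `T = U V` with `U i s = (ξ_iᵀ A_i)_s`, `V s j = (B_j η_j)_s`
  have hT : (Matrix.of fun i j => ξ i ⬝ᵥ ((A i * B j) *ᵥ η j)) =
      (Matrix.of fun i s => (ξ i ᵥ* A i) s) * (Matrix.of fun s j => (B j *ᵥ η j) s) := by
    ext i j
    simp only [Matrix.of_apply, Matrix.mul_apply]
    rw [← mulVec_mulVec, dotProduct_mulVec]
    rfl
  rw [hT]
  calc ((Matrix.of fun i s => (ξ i ᵥ* A i) s) * (Matrix.of fun s j => (B j *ᵥ η j) s)).rank
      ≤ (Matrix.of fun i s => (ξ i ᵥ* A i) s).rank := Matrix.rank_mul_le_left _ _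
    _ ≤ Fintype.card (Fin k) := Matrix.rank_le_card_width _
    _ = k := Fintype.card_fin k

end Thm58

end Literature.Combinatorics.Optimization
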